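import Summits.BirchSwinnertonDyer.BirchSwinnertonDyer.Theses.UniversalToricDescent
import Summits.BirchSwinnertonDyer.BirchSwinnertonDyer.Theorems.UniversalToricDescentTwinMemberRationalInclusionAtThreeOfTwoVarCore
import Summits.BirchSwinnertonDyer.BirchSwinnertonDyer.Theorems.UniversalToricDescentToricKernelAtThreeDegreeOnlyTwinOfPrint
import HarnessLib

/-!
# SKELETON v15 PROPOSAL (line `membertower`; width seat bsd-wall-utd-p2-w2 g8, 2026-08-28; NOT registered — the next LEAD decides)
# — crux ♭B′ `TwinWanFrameAtThreeMultTresT` (stmt-BirchSwinnertonDyer-27401) and ♭B′° `TwinDegreeFrameAtThreeMultTresT` (22539) BY NAME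

v15 = v14 (sha16 8ce0a415332e, LEAD g16) with the research stub RESHAPED ONE LEVEL UP THE PORT: `stub_memberRationalInclusionAtThree`
(K1♯ = the one-variable anticyclotomic Σ-inclusion for the members) ↦ `stub_twoVarCoreAtThree` (TV₃ = the TWO-VARIABLE CORE at the same
member data: for every cyclotomic `ℤ₃`-extension `κ′` with a generator, `X^Σ_K(A_{g_m}) := XBig κ′ (AnticyclotomicBigGaloisRep κ (A_{g_m}|Γ_K)) 𝔭′ Σ`
`Λ_K`-torsion ⇒ some `Q₂ ∈ 𝓞_{ℂ₃}⟦T_a⟧⟦T_c⟧` contains `Ch_{Λ_K}·𝓞_{ℂ₃}⟦T_a⟧⟦T_c⟧` and restricts on `T_c = 0` to `u · Q`, `Q` the member's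
Σ-frame), and the composition routed through the landed reduction p655790
`…TwinMemberRationalInclusionAtThreeOfTwoVarCore.twinWanFrameAtThreeMultTresT_of_thmB_of_nonsplitMembersFrames_of_twoVarCoreAtThree`
(TV₃ ⟹ K1♯ᵈ by the kernel descent [JSW17 Cor. 3.4.2] + exact control [JSW17 L. 3.4.1] at `p = 3`; K1♯ᵈ ⟹ ♭B′ because the twin's
très-ramifié binder supplies (dec) for every member through the congruence (b)).

WHY (numbers, not adjectives): K1♯ as registered also covers members with a `Γ_{ℚ₃}`-fixed `3`-torsion point on `A_g` (the `¬(dec)`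
corner, where the JSW descent is unavailable — bsd-stepL CORNER-25505); the très-ramifié twin never enters it. TV₃ is the statement
every engine of the port work-order (LEAD-NOTE-g16 §2 / LENS v26 §2: SU14 Thm 7.7 family bound → Beilinson–Flach bridge, weight `k_m`,
`p = 3`) would OUTPUT before descent, and the descent row of that work-order is now in the kernel. Nothing in print proves TV₃ at
`p = 3` (FW21 Thm 4.41 needs a non-split `q ∥ N`; KLZ17 §7.2 `p ≥ 5`): RESEARCH, same class as K1♯, one step shorter.

Stubs (v15): `stub_thmB` = item 20711 (PUB BY NAME) · `stub_pubMembersFramesCongruence` = item 22593 (PUB BY NAME, rev 70) ·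
`stub_twoVarCoreAtThree` = TV₃ (RESEARCH). Hardest stub: the last. lean rc 0 expected with exactly 3 sorries;
`TwinWanFrameAtThreeMultTresT_of` / `TwinDegreeFrameAtThreeMultTresT_of` conclude items 27401 / 22539 BY NAME.
This file is a PROPOSAL: it is not the registered skeleton (v14 stays the line of record until a LEAD runs `ledger skeleton check`
on this text). BSD is not proved by any of this; every `sorry` below is a stub.
-/

noncomputable section

open scoped Classical

set_option linter.dupNamespace false
set_option autoImplicit false

namespace Summit.BirchSwinnertonDyer.BirchSwinnertonDyer.Cruxes.TwinWanFrameAtThreeMultTresT.MemberTowerV15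

open PowerSeries WeierstrassCurve NumberField IsDedekindDomain Field
  Literature.NumberTheory.EllipticCurves
  Literature.NumberTheory.EllipticCurves.ModularForms
  Literature.NumberTheory.EllipticCurves.Rank1Residual
  Literature.NumberTheory.EllipticCurves.BigGaloisRep
  Literature.NumberTheory.EllipticCurves.GreenbergSelmer
  Literature.NumberTheory.GaloisRepresentations
  Summit.BirchSwinnertonDyer.BirchSwinnertonDyer.Theorems.SchneiderFree

/-- STUB (BY NAME = item stmt-BirchSwinnertonDyer-20711 `TwinHsiehThmBInput`; refereed; closes only by formalisation):
Hsieh 2014 Thm. B at every level. [cite: Hsieh2014, Thm. B p. 712 (Doc. Math. 19)] -/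
theorem stub_thmB : Hsieh2014.thmB_exists_isHsiehLFunction_coeff_norm_eq_one_unrPeriod_anyLevel := by
  sorry

/-- STUB (BY NAME = item stmt-BirchSwinnertonDyer-22593 `TwinCastellaMembersFramesCongruenceOddInput`, route rev 70; PUBLISHED by
reading; closes only by formalisation): Castella JIMJ 2020 §2 Def. 2.10 / Thm. 2.11 at an odd prime with the erratum's hypothesis (iii)
(p643788). [cite: Castella2020JIMJ, §2 Def. 2.10, Thm. 2.11] [cite: Castella2018Erratum, Thm. 1.1 (iii)] [cite: Skinner2016PacificMC, §2.6, §3.1] -/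
theorem stub_pubMembersFramesCongruence :
    Castella2018.castella2020_thm211_members_frames_sigma_congruence_odd_nonsplit := by
  sorry

/-- STUB (RESEARCH, v15; hardest stub): TV₃ — the TWO-VARIABLE CORE at `p = 3` for the residually irreducible, (dec) Hida members of
the twin at depth `m ≥ 1`: for every cyclotomic `κ′` (generator `γ′`), `X^Σ_K(A_{g_m})` `Λ_K`-torsion ⇒ `∃ Q₂ ⊇ Ch_{Λ_K}(X^Σ_K(A_{g_m}))`
(read through `b`) with `Q₂(T_c = 0) = u · Q`. = hypothesis `hTV` of p655790's `sharpDec_of_twoVarCoreAtThree` VERBATIM; bsd-stepL's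
`stub_FW21_twoVarSigmaLePinned` (S1 of crux 25505) with `3 < p` and (iii) removed. Engine (port, no print at 3): SU14 Thm 7.7 + Prop
13.6 (1) at `φ_m` (two-variable ord-side bound) → Beilinson–Flach explicit reciprocity (KLZ17 Thm B; YZ26 Thm 4.7) to the Greenberg
side → weight-`k` two-variable BDP comparison (CGS25 Prop 2.4.5 / Cas20 Thm 2.11) pinning `T_c = 0` to the Σ-frame.
[cite: YanZhu2026, Thm. 4.4, Thm. 4.7] [cite: SkinnerUrban2014, Thm. 7.7, Prop. 13.6 (1)] [cite: KingsLoefflerZerbes2017, Thm. B, §7.2]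
[cite: FouquetWan2021, Thm. 4.41, App. B Cor. 7.21] [cite: JetchevSkinnerWan2017, §3.4] -/
theorem stub_twoVarCoreAtThree :
    ∀ (W' : WeierstrassCurve ℚ) [W'.IsElliptic] [W'.IsGloballyMinimal] (N' : ℕ) [NeZero N']
      (K : Type) [Field K] [NumberField K] (Dt' : ModularParametrizationData W' N'),
      Mult W' 3 → W'.HasSurjectiveModNGaloisRep 3 → W'.conductorNorm ℤ = N' → IsImaginaryQuadratic K →
      SatisfiesHeegnerHypothesis N' K → Odd (NumberField.discr K) →
      ∀ (κ : ZpExtension K 3), κ.IsAnticyclotomic → ∀ (γ : absoluteGaloisGroup K) [Fact (κ.IsTopGenerator γ)]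
        (𝔭 : HeightOneSpectrum (𝓞 K)), ((3 : ℕ) : 𝓞 K) ∈ 𝔭.asIdeal →
        𝔭.asIdeal.ramificationIdx (𝓞 ℚ) = 1 → 𝔭.asIdeal.inertiaDeg (𝓞 ℚ) = 1 →
        ∀ (𝔭' : HeightOneSpectrum (𝓞 K)), ((3 : ℕ) : 𝓞 K) ∈ 𝔭'.asIdeal → 𝔭' ≠ 𝔭 →
        ∀ (ι' : PadicAlgCl 3 ≃+* ℂ), BranchInducesPrime 3 ι' 𝔭 →
        ∀ (m : ℕ), 1 ≤ m → ∀ (D : Skinner2016.HidaCongruentMember W' 3 m),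
          SkinnerUrban2014.IsResiduallyIrreducible D.Δ →
          (∀ a : Cofree D.Δ.ρ (padicCoeffField D.ι),
              (∀ σ : LocalGroup K (Sum.inl 𝔭'), (D.Δ.cofreeRepOver K) (localMap K (Sum.inl 𝔭') σ) a = a) →
              (∃ j : ℕ, (3 : ℕ) ^ j • a = 0) → a = 0) →
          (∀ x : coeffField D.g, ι' (D.ι x) = (x : ℂ)) →
        ∀ (b : padicCoeffIntegers D.ι →+* 𝓞_ℂ_[3]),
          (∀ x, ((b x : 𝓞_ℂ_[3]) : ℂ_[3]) = algebraMap (PadicAlgCl 3) ℂ_[3] (padicCoeffIntegers.toPadicAlgCl D.ι x)) →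
        ∀ (ΩK : ℂ) (Ωp : (𝓞_ℂ_[3])ˣ) (Q : PowerSeries 𝓞_ℂ_[3]), ΩK ≠ 0 →
          IsBDPLFunctionWtSigmaInt ι' 𝔭 κ γ D.g (W'.sigmaPlacesFinset 3 K) ΩK ((Ωp : 𝓞_ℂ_[3]) : ℂ_[3]) Q →
        ∀ (κ' : ZpExtension K 3) (γ' : absoluteGaloisGroup K) [Fact (κ'.IsTopGenerator γ')], κ'.IsCyclotomic →
        ∀ [TopologicalSpace (PowerSeries (padicCoeffIntegers D.ι))]
          [TopologicalSpace (PowerSeries (PowerSeries (padicCoeffIntegers D.ι)))]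
          [ContinuousSMul (PowerSeries (PowerSeries (padicCoeffIntegers D.ι)))
            (BigRepModule (PowerSeries (padicCoeffIntegers D.ι)) 3
              (BigRepModule (padicCoeffIntegers D.ι) 3 (Cofree D.Δ.ρ (padicCoeffField D.ι))))],
          Module.IsTorsion (PowerSeries (PowerSeries (padicCoeffIntegers D.ι)))
              (XBig κ' (AnticyclotomicBigGaloisRep κ (D.Δ.cofreeRepOver K)) 𝔭' (↑(W'.sigmaPlacesFinset 3 K))) →
            ∃ Q₂ : PowerSeries (PowerSeries 𝓞_ℂ_[3]),
              (∃ u : (PowerSeries 𝓞_ℂ_[3])ˣ, PowerSeries.constantCoeff Q₂ = (u : PowerSeries 𝓞_ℂ_[3]) * Q) ∧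
              (XBig.charIdeal κ' (AnticyclotomicBigGaloisRep κ (D.Δ.cofreeRepOver K)) 𝔭'
                  (↑(W'.sigmaPlacesFinset 3 K))).map (PowerSeries.map (PowerSeries.map b)) ≤ Ideal.span {Q₂} := by
  sorry

/-- COMPOSITION (v15): ♭B′ `TwinWanFrameAtThreeMultTresT` (item stmt-BirchSwinnertonDyer-27401) BY NAME from the three stubs, through
p655790 §3 (TV₃ ⟹ K1♯ᵈ ⟹ ♭B′; Hsieh Thm B + `…_odd_nonsplit` supply the R₀-frame and the members). [folklore] -/
theorem TwinWanFrameAtThreeMultTresT_of :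
    Summit.BirchSwinnertonDyer.BirchSwinnertonDyer.Theses.UniversalToricDescent.TwinWanFrameAtThreeMultTresT :=
  Summit.BirchSwinnertonDyer.BirchSwinnertonDyer.Theorems.UniversalToricDescentTwinMemberRationalInclusionAtThreeOfTwoVarCore.twinWanFrameAtThreeMultTresT_of_thmB_of_nonsplitMembersFrames_of_twoVarCoreAtThree
    stub_thmB stub_pubMembersFramesCongruence stub_twoVarCoreAtThree

/-- COMPOSITION (v15, act DEG): ♭B′° `TwinDegreeFrameAtThreeMultTresT` (item stmt-BirchSwinnertonDyer-22539) BY NAME, from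
`TwinWanFrameAtThreeMultTresT_of` and the landed monotonicity ♭B′ ⟹ ♭B′° (p640116 §4). [folklore] -/
theorem TwinDegreeFrameAtThreeMultTresT_of :
    Summit.BirchSwinnertonDyer.BirchSwinnertonDyer.Theses.UniversalToricDescent.TwinDegreeFrameAtThreeMultTresT :=
  Summit.BirchSwinnertonDyer.BirchSwinnertonDyer.Theorems.UniversalToricDescentKernelDegreeOnlyTwinOfPrint.twinDegreeFrameMultTresT_of_wanFrame
    TwinWanFrameAtThreeMultTresT_of

end Summit.BirchSwinnertonDyer.BirchSwinnertonDyer.Cruxes.TwinWanFrameAtThreeMultTresT.MemberTowerV15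

end
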